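import Mathlib
import HarnessLib
import Summits.HubbardSuperconductivity.HubbardSuperconductivity.Theorems.KLProgrammeKLRegimeWickCrossContractionGramSized
import Summits.HubbardSuperconductivity.HubbardSuperconductivity.Theorems.KLProgrammeKLRegimeWickCrossContractionSector

/-!
# Route `KLProgramme` — ENGINE child gen 6 (stmt-HubbardSuperconductivity-20236 `KLRegimeEngineV16`), `stub_engine_step_values` (E2-v10):
# the `k`-line two-vertex term with a Gram tail ON `klAnisoFamily … n` SECTOR FIELDS — value and norm forms in engine currency
# (cell gate-hubbard-kl, seat p5 g5; corollaries of `…WickCrossContractionGramValue` (p518743) / `…GramSized`)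

The engine's sector family is `klAnisoFamily L M β μ K e₀ n` (the (E1)/(E1-F) carriers `klAnisoLegKernelNorm(At)`, `KernelNormsV4/Levels` are stated in it);
its overlap count in product form is `≤ 9` (`card_overlap_klAnisoFamily_mul_le_nine`, p508129), so each explicit sup line `1 … e'` costs `36·δ_i`:

* **`norm_kernel_crossContract_value_sectorPreimage_klAniso_le_gram`** — VALUE form (every output leg fixed): `Ga` at level `m₀ + 1`, `Gb` at level
  `e' + 1 + m₁` (choose `e' = 4 − m₁` for the top of BGM (2.98)), Gram tail `(Σ_i κ_i²)^{k−e'−1}/(k−e'−1)!` — no factorial in `k`;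
* **`sum_norm_kernel_crossContract_sectorPreimage_klAniso_le_gram`** — NORM form (output leg pinned at a free leg of `Ga`): `Ga` plain, `Gb` at
  level `e'`.

Pure bookkeeping; no definitions, no named facts, nothing about sizes is asserted.
-/

noncomputable section

namespace Summit.HubbardSuperconductivity.HubbardSuperconductivity.Theorems.KLRegimeWick

set_option linter.dupNamespace false -- summit = problem name (single-conjunct summit), D-0017

open Literature.MathematicalPhysics.QuantumLattice Literature.Probability.LatticeModels GrassmannAlgebra Finset Matrix
open Summit.HubbardSuperconductivity.HubbardSuperconductivity.Theorems.KLRegimeSplit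
open Summit.HubbardSuperconductivity.HubbardSuperconductivity.Theorems.KLProgrammeLegKernels
open Summit.HubbardSuperconductivity.HubbardSuperconductivity.Theorems.PerturbedFermiCurve

section Aniso

variable {L M : ℕ} [NeZero L] {e₀ : ℝ} (he₀ : 0 < e₀) {β : ℝ} (hβ : 0 ≤ β) (μ : ℝ) (K : TrigPolyC4v) (n : ℕ)
include he₀ hβ

/-- **Value form with a Gram tail between two `klAnisoFamily … n`-sector preimages** (every output leg fixed; `e' + 1` explicit lines, the first in
`L¹` (row/column sums `≤ α`), the next `e'` sup × sector-diagonal (`36·δ_i`), the other `k − e' − 1` Gram (`κ_i`)): `Ga` at level `m₀ + 1`, `Gb` at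
level `e' + 1 + m₁`. [cite: BenfattoGiulianiMastropietro2006, §2.8 (2.80)] -/
theorem norm_kernel_crossContract_value_sectorPreimage_klAniso_le_gram {k e' m m₀ m₁ : ℕ} (he : e' + 1 ≤ k)
    (sym : Fin k → FreqMomentum L M × Fin 2 → ℂ) (κ : Fin k → ℝ)
    (hκF : ∀ (i : Fin k) (Y : SpaceTimeIdx L M × SectorLeg (sectorCount n)), Y.2.2 = 0 →
      ‖sectorGramF L M β (klAnisoFamily L M β μ K e₀ n) (sym i) Y‖ ≤ κ i)
    (hκG : ∀ (i : Fin k) (Y : SpaceTimeIdx L M × SectorLeg (sectorCount n)), Y.2.2 = 1 →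
      ‖sectorGramG L M β (klAnisoFamily L M β μ K e₀ n) (sym i) Y‖ ≤ κ i)
    (Ga Gb : HubbardGrassmann L M) (s : Fin m → Fin 2)
    (hm₀ : (univ.filter fun i => s i = 0).card = m₀ + 1) (hm₁ : (univ.filter fun i => s i = 1).card = m₁)
    (Z : Fin m → SpaceTimeIdx L M × SectorLeg (sectorCount n)) {α : ℝ} (hα : 0 ≤ α)
    (hrow : ∀ X, ∑ Y, ‖((sectorSubMatrix L M β (klAnisoFamily L M β μ K e₀ n)).transpose * normalCovariance L M (sym (Fin.castLE he 0)) *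
      sectorSubMatrix L M β (klAnisoFamily L M β μ K e₀ n)) X Y‖ ≤ α)
    (hcol : ∀ Y, ∑ X, ‖((sectorSubMatrix L M β (klAnisoFamily L M β μ K e₀ n)).transpose * normalCovariance L M (sym (Fin.castLE he 0)) *
      sectorSubMatrix L M β (klAnisoFamily L M β μ K e₀ n)) X Y‖ ≤ α)
    (δ : Fin e' → ℝ) (hδ : ∀ i, 0 ≤ δ i)
    (hent : ∀ (i : Fin e') X Y, ‖((sectorSubMatrix L M β (klAnisoFamily L M β μ K e₀ n)).transpose *
      normalCovariance L M (sym (Fin.castLE he i.succ)) * sectorSubMatrix L M β (klAnisoFamily L M β μ K e₀ n)) X Y‖ ≤ δ i)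
    {Na Nb : ℝ} (hNb0 : 0 ≤ Nb)
    (hNa : ∀ σ₀ : Fin (m₀ + 1) → SectorLeg (sectorCount n), hubbardSectorKernelNorm L M β (klAnisoFamily L M β μ K e₀ n) (prescribedTuples univ
      (Fin.append (fun _ : Fin k => (none : Option (SectorLeg (sectorCount n)))) (fun j => some (σ₀ j)))) Ga ≤ Na)
    (hNb : ∀ (ω₀ : SectorLeg (sectorCount n)) (τ' : Fin e' → SectorLeg (sectorCount n)) (ω₁ : Fin m₁ → SectorLeg (sectorCount n)),
      hubbardSectorKernelNorm L M β (klAnisoFamily L M β μ K e₀ n) (prescribedTuples univ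
        (Fin.append (fun i : Fin k => if h : (i : ℕ) < e' + 1 then some ((Fin.cons ω₀ τ' : Fin (e' + 1) → SectorLeg (sectorCount n)) ⟨i, h⟩)
          else none) (fun j => some (ω₁ j)))) Gb ≤ Nb) :
    ‖kernel ℂ (((List.ofFn fun i => grassmannLaplacian ℂ (crossCov ℂ
        ((sectorSubMatrix L M β (klAnisoFamily L M β μ K e₀ n)).transpose * normalCovariance L M (sym i) *
          sectorSubMatrix L M β (klAnisoFamily L M β μ K e₀ n)))).reverse).prod
        (dblCopy ℂ 0 (sectorPreimage β (klAnisoFamily L M β μ K e₀ n) Ga) *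
          dblCopy ℂ 1 (sectorPreimage β (klAnisoFamily L M β μ K e₀ n) Gb))) m (fun i => (Z i, s i))‖ ≤
      (((k + (m₀ + 1)).factorial * (k + m₁).factorial : ℝ) / (m.factorial * (k - (e' + 1)).factorial)) *
        (∑ i, κ i ^ 2) ^ (k - (e' + 1)) *
        (α * (∏ i, δ i * 36) * (imagTimeWeight β M * Na) * (imagTimeWeight β M * Nb)) := by
  have h := norm_kernel_crossContract_value_sectorPreimage_le_gram he hβ (klAnisoFamily L M β μ K e₀ n)
    (card_overlap_klAnisoFamily_mul_le_nine he₀ β μ K n) sym κ hκF hκG Ga Gb s hm₀ hm₁ Z hα hrow hcol δ hδ hent hNb0 hNa hNb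
  have e : (∏ i, δ i * ((4 * 9 : ℕ) : ℝ)) = ∏ i, δ i * 36 := prod_congr rfl fun i _ => by push_cast; norm_num
  rwa [e] at h

/-- **Norm form with a Gram tail between two `klAnisoFamily … n`-sector preimages, pinned at a free leg of `Ga`**: `Ga` plain (`‖Ga‖_{k+m₀, univ}`),
`Gb` pinned at its line-`0` leg with the sectors of its explicit legs `1 … e'` prescribed (level `e'`).
[cite: BenfattoGiulianiMastropietro2006, §2.8 (2.80)] -/
theorem sum_norm_kernel_crossContract_sectorPreimage_klAniso_le_gram {k e' m m₀ m₁ : ℕ} (he : e' + 1 ≤ k)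
    (sym : Fin k → FreqMomentum L M × Fin 2 → ℂ) (κ : Fin k → ℝ)
    (hκF : ∀ (i : Fin k) (Y : SpaceTimeIdx L M × SectorLeg (sectorCount n)), Y.2.2 = 0 →
      ‖sectorGramF L M β (klAnisoFamily L M β μ K e₀ n) (sym i) Y‖ ≤ κ i)
    (hκG : ∀ (i : Fin k) (Y : SpaceTimeIdx L M × SectorLeg (sectorCount n)), Y.2.2 = 1 →
      ‖sectorGramG L M β (klAnisoFamily L M β μ K e₀ n) (sym i) Y‖ ≤ κ i)
    (Ga Gb : HubbardGrassmann L M) (s : Fin m → Fin 2)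
    (hm₀ : (univ.filter fun i => s i = 0).card = m₀) (hm₁ : (univ.filter fun i => s i = 1).card = m₁) (p : Fin m) (hp : s p = 0)
    (z : SpaceTimeIdx L M × SectorLeg (sectorCount n)) {α : ℝ}
    (hrow : ∀ X, ∑ Y, ‖((sectorSubMatrix L M β (klAnisoFamily L M β μ K e₀ n)).transpose * normalCovariance L M (sym (Fin.castLE he 0)) *
      sectorSubMatrix L M β (klAnisoFamily L M β μ K e₀ n)) X Y‖ ≤ α)
    (hcol : ∀ Y, ∑ X, ‖((sectorSubMatrix L M β (klAnisoFamily L M β μ K e₀ n)).transpose * normalCovariance L M (sym (Fin.castLE he 0)) *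
      sectorSubMatrix L M β (klAnisoFamily L M β μ K e₀ n)) X Y‖ ≤ α)
    (δ : Fin e' → ℝ) (hδ : ∀ i, 0 ≤ δ i)
    (hent : ∀ (i : Fin e') X Y, ‖((sectorSubMatrix L M β (klAnisoFamily L M β μ K e₀ n)).transpose *
      normalCovariance L M (sym (Fin.castLE he i.succ)) * sectorSubMatrix L M β (klAnisoFamily L M β μ K e₀ n)) X Y‖ ≤ δ i)
    {Nb : ℝ} (hNb0 : 0 ≤ Nb)
    (hNb : ∀ τ' : Fin e' → SectorLeg (sectorCount n), hubbardSectorKernelNorm L M β (klAnisoFamily L M β μ K e₀ n) (prescribedTuples univ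
      (Fin.append (fun i : Fin k => if h : (i : ℕ) < e' + 1 then
        (Fin.cons none (fun j => some (τ' j)) : Fin (e' + 1) → Option (SectorLeg (sectorCount n))) ⟨i, h⟩ else none)
        (fun _ : Fin m₁ => none))) Gb ≤ Nb) :
    ∑ Z ∈ univ.filter (fun Z : Fin m → SpaceTimeIdx L M × SectorLeg (sectorCount n) => Z p = z),
        ‖kernel ℂ (((List.ofFn fun i => grassmannLaplacian ℂ (crossCov ℂ
            ((sectorSubMatrix L M β (klAnisoFamily L M β μ K e₀ n)).transpose * normalCovariance L M (sym i) *
              sectorSubMatrix L M β (klAnisoFamily L M β μ K e₀ n)))).reverse).prod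
          (dblCopy ℂ 0 (sectorPreimage β (klAnisoFamily L M β μ K e₀ n) Ga) *
            dblCopy ℂ 1 (sectorPreimage β (klAnisoFamily L M β μ K e₀ n) Gb))) m (fun i => (Z i, s i))‖ ≤
      (((k + m₀).factorial * (k + m₁).factorial : ℝ) / (m.factorial * (k - (e' + 1)).factorial)) * (∑ i, κ i ^ 2) ^ (k - (e' + 1)) *
        (α * (∏ i, δ i * 36) *
          (imagTimeWeight β M * hubbardSectorKernelNorm L M β (klAnisoFamily L M β μ K e₀ n)
            (univ : Finset (Fin (k + m₀) → SectorLeg (sectorCount n))) Ga) *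
          (imagTimeWeight β M * Nb)) := by
  have h := sum_norm_kernel_crossContract_sectorPreimage_le_gram he hβ (klAnisoFamily L M β μ K e₀ n)
    (card_overlap_klAnisoFamily_mul_le_nine he₀ β μ K n) sym κ hκF hκG Ga Gb s hm₀ hm₁ p hp z hrow hcol δ hδ hent hNb0 hNb
  have e : (∏ i, δ i * ((4 * 9 : ℕ) : ℝ)) = ∏ i, δ i * 36 := prod_congr rfl fun i _ => by push_cast; norm_num
  rwa [e] at h

end Aniso

end Summit.HubbardSuperconductivity.HubbardSuperconductivity.Theorems.KLRegimeWick

end
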